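import Literature.Topology.FourManifolds.CappellShanesonClassGroupThirtyfive
import Literature.Topology.FourManifolds.CappellShanesonClassGroupThirtyfiveCls
import Literature.Topology.FourManifolds.CappellShanesonTotallyReal
import Literature.Topology.FourManifolds.CappellShanesonClassGroupTwelve
import Literature.Topology.FourManifolds.CappellShanesonClassGroupFifteen
import HarnessLib

/-!
# Trace `35`: the class group, the cover of `C(ℤ[Θ₃₅])`, Gompf's conjecture for the traces `35` and `-30`

Part 'Main' of the certified class-group computation for the trace `35` field behind
Kim–Yamada's Theorem B (`GompfConjectureForTrace 35` and, by Theorem A, `-30`), serving the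
named fact
`Literature.Topology.FourManifolds.kimYamada2023_nonempty_diffeomorph_sphere_four_of_trace_mem_Icc`
(`CappellShaneson.lean`; M. H. Kim, S. Yamada, Kyungpook Math. J. 63 (2023) 373–411 =
arXiv:1707.03860, Cor. C). The computation is split over several files only because of the
proposal size limit: `…ClassGroupThirtyfive.lean` (discriminant, `𝓞 K = ℤ[θ]`, the primes of small norm), `…ClassGroupThirtyfiveRel<k>.lean` (two-ideal relations with certified generators and the non-vanishing of the generators), `…ClassGroupThirtyfiveCls.lean` (the class of every small prime in terms of the generator(s), the order relations), `…ClassGroupThirtyfiveMain.lean` (generation of the class group by Minkowski's bound, the cover of `C(ℤ[Θ])` by standard-matrix representatives, Gompf's conjecture for the two traces). (File generated from a certified computation; every relation is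
checked by the Lean kernel; no named fact is introduced, D-0026.)

## References

* [KimYamada2023] M. H. Kim, S. Yamada, Kyungpook Math. J. 63 (2023) 373–411 (arXiv:1707.03860):
  §2.3 (Prop. 2.14), §6.1 (Lemma 6.1 and the proof of Thm. B), Thm. A.
* [Marcus2018] D. A. Marcus, *Number Fields*, 2nd ed., Ch. 3, Thm. 27 (Dedekind–Kummer); Ch. 5,
  Cor. 2 of Thm. 37 (Minkowski bound) and the class-group computations after it.
-/

noncomputable section

open Set Polynomial Module NumberField Ideal
open scoped NumberField MatrixGroups nonZeroDivisors
open Literature.LinearAlgebra.Matrix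

namespace Literature.Topology.FourManifolds

section Field

variable {K : Type*} [Field K] [NumberField K] {θ : K}

set_option maxHeartbeats 2000000 in
/-- **Every ideal class of the trace `35` field is a power `aʳ`, `0 ≤ r < 10`, of `a = [(5, θ - 2)]`,
represented by the ideals listed** (so the class number divides `10`). Proof: `d_K = 1108777`,
`⌊M_K⌋ ≤ 233`, Dedekind–Kummer at `p ≤ 233`, and the class of every small prime computed above
from two-ideal relations with certified generators. [cite: KimYamada2023, §6.1 (proof of Thm. B)] -/
theorem classGroup_mem_thirtyfive (hθ : aeval θ (csPoly 35) = 0) (h3 : finrank ℚ K = 3)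
    (C : ClassGroup (𝓞 K)) :
    C = 1 ∨
      C = ClassGroup.mk0 ⟨span {(5 : 𝓞 K), thetaInt hθ - 2}, (span_pair_ofNat_mem_nonZeroDivisors (nat_lit 5) (thetaInt hθ - 2))⟩ ∨
      C = ClassGroup.mk0 ⟨span {(29 : 𝓞 K), thetaInt hθ - 16}, (span_pair_ofNat_mem_nonZeroDivisors (nat_lit 29) (thetaInt hθ - 16))⟩ ∨
      C = ClassGroup.mk0 ⟨span {(29 : 𝓞 K), thetaInt hθ - 13}, (span_pair_ofNat_mem_nonZeroDivisors (nat_lit 29) (thetaInt hθ - 13))⟩ ∨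
      C = ClassGroup.mk0 ⟨span {(11 : 𝓞 K), thetaInt hθ - 3}, (span_pair_ofNat_mem_nonZeroDivisors (nat_lit 11) (thetaInt hθ - 3))⟩ ∨
      C = ClassGroup.mk0 ⟨span {(19 : 𝓞 K), thetaInt hθ - 4}, (span_pair_ofNat_mem_nonZeroDivisors (nat_lit 19) (thetaInt hθ - 4))⟩ ∨
      C = ClassGroup.mk0 ⟨span {(17 : 𝓞 K), thetaInt hθ - 3}, (span_pair_ofNat_mem_nonZeroDivisors (nat_lit 17) (thetaInt hθ - 3))⟩ ∨
      C = ClassGroup.mk0 ⟨span {(37 : 𝓞 K), thetaInt hθ - 17}, (span_pair_ofNat_mem_nonZeroDivisors (nat_lit 37) (thetaInt hθ - 17))⟩ ∨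
      C = ClassGroup.mk0 ⟨span {(7 : 𝓞 K), thetaInt hθ - 5}, (span_pair_ofNat_mem_nonZeroDivisors (nat_lit 7) (thetaInt hθ - 5))⟩ ∨
      C = ClassGroup.mk0 ⟨span {(13 : 𝓞 K), thetaInt hθ - 2}, (span_pair_ofNat_mem_nonZeroDivisors (nat_lit 13) (thetaInt hθ - 2))⟩ := by
  classical
  obtain ⟨a, ha⟩ : ∃ a : ClassGroup (𝓞 K), ClassGroup.mk0 ⟨span {(5 : 𝓞 K), thetaInt hθ - 2}, (span_pair_ofNat_mem_nonZeroDivisors (nat_lit 5) (thetaInt hθ - 2))⟩ = a := ⟨_, rfl⟩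
  have ham : a ^ (10 : ℤ) = 1 := by rw [← ha]; exact pow_order_thirtyfive hθ
  let H : Subgroup (ClassGroup (𝓞 K)) := Subgroup.zpowers a
  have hprinc : ∀ (P : Ideal (𝓞 K)) (hP0 : P ∈ (Ideal (𝓞 K))⁰) (x : 𝓞 K), P = span {x} →
      ClassGroup.mk0 ⟨P, hP0⟩ ∈ H := by
    intro P hP0 x hPx
    have : ClassGroup.mk0 ⟨P, hP0⟩ = 1 :=
      (ClassGroup.mk0_eq_one_iff hP0).mpr ⟨⟨x, by rw [hPx, submodule_span_eq]⟩⟩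
    rw [this]
    exact H.one_mem
  -- Minkowski: `⌊M_K⌋ ≤ 233`
  have hd : ((|NumberField.discr K| : ℤ) : ℝ) ≤ (1108777 : ℕ) := by
    rw [discr_eq_thirtyfive hθ h3]
    norm_num
  have hfloor := floor_minkowskiBound_le_cubic_real h3 (nrComplexPlaces_eq_zero_of_csPoly hθ h3 (by norm_num))
    hd (s := 1052.99) (U := 233) (by norm_num) (by norm_num) (by norm_num)
  have htop : H = ⊤ := by
    refine classGroup_subgroup_eq_top_of_primesOver H hfloor fun p hp hprime P hP0 hP hle => ?_
    have hpU : p ≤ 233 := (Finset.mem_Icc.mp hp).2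
    have h1p : 1 ≤ p := (Finset.mem_Icc.mp hp).1
    interval_cases p
    · exact absurd hprime (by norm_num)
    · exact hprinc P hP0 _ (eq_span_of_inert_thirtyfive hθ h3 (by norm_num) hP)
    · exact hprinc P hP0 _ (eq_span_of_inert_thirtyfive hθ h3 (by norm_num) hP)
    · exact absurd hprime (by norm_num)
    · -- `p = 5`
      rcases eq_P5_or_eq_Q5_thirtyfive hθ h3 hP with h | h <;> subst h
      · rw [show ClassGroup.mk0 ⟨_, hP0⟩ = ClassGroup.mk0 ⟨span {(5 : 𝓞 K), thetaInt hθ - 2}, (span_pair_ofNat_mem_nonZeroDivisors (nat_lit 5) (thetaInt hθ - 2))⟩ from rfl, ha]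
        exact Subgroup.mem_zpowers a
      · exact mem_zpowers_of_mk0_eq a (cls_Q5_thirtyfive hθ) ha
    · exact absurd hprime (by norm_num)
    · -- `p = 7`
      rcases eq_P7_or_eq_Q7_thirtyfive hθ h3 hP with h | h <;> subst h
      · exact mem_zpowers_of_mk0_eq a (cls_P7_5_thirtyfive hθ) ha
      · exact mem_zpowers_of_mk0_eq a (cls_Q7_thirtyfive hθ) ha
    · exact absurd hprime (by norm_num)
    · exact absurd hprime (by norm_num)
    · exact absurd hprime (by norm_num)
    · -- `p = 11`
      rcases eq_P11_or_eq_Q11_thirtyfive hθ h3 hP with h | h <;> subst h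
      · exact mem_zpowers_of_mk0_eq a (cls_P11_3_thirtyfive hθ) ha
      · exact mem_zpowers_of_mk0_eq a (cls_Q11_thirtyfive hθ) ha
    · exact absurd hprime (by norm_num)
    · -- `p = 13`
      rcases eq_P13_or_eq_Q13_thirtyfive hθ h3 hP with h | h <;> subst h
      · exact mem_zpowers_of_mk0_eq a (cls_P13_2_thirtyfive hθ) ha
      · exact mem_zpowers_of_mk0_eq a (cls_Q13_thirtyfive hθ) ha
    · exact absurd hprime (by norm_num)
    · exact absurd hprime (by norm_num)
    · exact absurd hprime (by norm_num)
    · -- `p = 17`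
      have h := eq_span_pair_of_unique_root_thirtyfive hθ h3 (Or.inl ⟨rfl, rfl⟩) hP hle
      simp only [Nat.cast_ofNat, Int.cast_ofNat] at h
      subst h
      exact mem_zpowers_of_mk0_eq a (cls_P17_3_thirtyfive hθ) ha
    · exact absurd hprime (by norm_num)
    · -- `p = 19`
      have h := eq_span_pair_of_unique_root_thirtyfive hθ h3 (Or.inr (Or.inl ⟨rfl, rfl⟩)) hP hle
      simp only [Nat.cast_ofNat, Int.cast_ofNat] at h
      subst h
      exact mem_zpowers_of_mk0_eq a (cls_P19_4_thirtyfive hθ) ha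
    · exact absurd hprime (by norm_num)
    · exact absurd hprime (by norm_num)
    · exact absurd hprime (by norm_num)
    · exact hprinc P hP0 _ (eq_span_of_inert_thirtyfive hθ h3 (by norm_num) hP)
    · exact absurd hprime (by norm_num)
    · exact absurd hprime (by norm_num)
    · exact absurd hprime (by norm_num)
    · exact absurd hprime (by norm_num)
    · exact absurd hprime (by norm_num)
    · -- `p = 29` (splits)
      rcases eq_P29_thirtyfive hθ h3 hP with h | h | h <;> subst h
      · exact mem_zpowers_of_mk0_eq a (cls_P29_6_thirtyfive hθ) ha
      · exact mem_zpowers_of_mk0_eq a (cls_P29_13_thirtyfive hθ) ha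
      · exact mem_zpowers_of_mk0_eq a (cls_P29_16_thirtyfive hθ) ha
    · exact absurd hprime (by norm_num)
    · -- `p = 31` (ramified)
      rcases eq_P31_thirtyfive hθ h3 hP with h | h | h <;> subst h
      · exact mem_zpowers_of_mk0_eq a (cls_P31_8_thirtyfive hθ) ha
      · exact mem_zpowers_of_mk0_eq a (cls_P31_29_thirtyfive hθ) ha
      · exact mem_zpowers_of_mk0_eq a (cls_P31_29_thirtyfive hθ) ha
    · exact absurd hprime (by norm_num)
    · exact absurd hprime (by norm_num)
    · exact absurd hprime (by norm_num)
    · exact absurd hprime (by norm_num)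
    · exact absurd hprime (by norm_num)
    · -- `p = 37`
      have h := eq_span_pair_of_unique_root_thirtyfive hθ h3 (Or.inr (Or.inr (Or.inl ⟨rfl, rfl⟩))) hP hle
      simp only [Nat.cast_ofNat, Int.cast_ofNat] at h
      subst h
      exact mem_zpowers_of_mk0_eq a (cls_P37_17_thirtyfive hθ) ha
    · exact absurd hprime (by norm_num)
    · exact absurd hprime (by norm_num)
    · exact absurd hprime (by norm_num)
    · -- `p = 41`
      have h := eq_span_pair_of_unique_root_thirtyfive hθ h3 (Or.inr (Or.inr (Or.inr (Or.inl ⟨rfl, rfl⟩)))) hP hle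
      simp only [Nat.cast_ofNat, Int.cast_ofNat] at h
      subst h
      exact mem_zpowers_of_mk0_eq a (cls_P41_35_thirtyfive hθ) ha
    · exact absurd hprime (by norm_num)
    · -- `p = 43`
      have h := eq_span_pair_of_unique_root_thirtyfive hθ h3 (Or.inr (Or.inr (Or.inr (Or.inr (Or.inl ⟨rfl, rfl⟩))))) hP hle
      simp only [Nat.cast_ofNat, Int.cast_ofNat] at h
      subst h
      exact mem_zpowers_of_mk0_eq a (cls_P43_21_thirtyfive hθ) ha
    · exact absurd hprime (by norm_num)
    · exact absurd hprime (by norm_num)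
    · exact absurd hprime (by norm_num)
    · -- `p = 47` (ramified)
      rcases eq_P47_thirtyfive hθ h3 hP with h | h | h <;> subst h
      · exact mem_zpowers_of_mk0_eq a (cls_P47_8_thirtyfive hθ) ha
      · exact mem_zpowers_of_mk0_eq a (cls_P47_37_thirtyfive hθ) ha
      · exact mem_zpowers_of_mk0_eq a (cls_P47_37_thirtyfive hθ) ha
    · exact absurd hprime (by norm_num)
    · exact absurd hprime (by norm_num)
    · exact absurd hprime (by norm_num)
    · exact absurd hprime (by norm_num)
    · exact absurd hprime (by norm_num)
    · exact hprinc P hP0 _ (eq_span_of_inert_thirtyfive hθ h3 (by norm_num) hP)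
    · exact absurd hprime (by norm_num)
    · exact absurd hprime (by norm_num)
    · exact absurd hprime (by norm_num)
    · exact absurd hprime (by norm_num)
    · exact absurd hprime (by norm_num)
    · -- `p = 59` (splits)
      rcases eq_P59_thirtyfive hθ h3 hP with h | h | h <;> subst h
      · exact mem_zpowers_of_mk0_eq a (cls_P59_18_thirtyfive hθ) ha
      · exact hprinc _ hP0 _ (P59_30_eq_thirtyfive hθ)
      · exact mem_zpowers_of_mk0_eq a (cls_P59_46_thirtyfive hθ) ha
    · exact absurd hprime (by norm_num)
    · exact hprinc P hP0 _ (eq_span_of_inert_thirtyfive hθ h3 (by norm_num) hP)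
    · exact absurd hprime (by norm_num)
    · exact absurd hprime (by norm_num)
    · exact absurd hprime (by norm_num)
    · exact absurd hprime (by norm_num)
    · exact absurd hprime (by norm_num)
    · -- `p = 67`
      have h := eq_span_pair_of_unique_root_thirtyfive hθ h3 (Or.inr (Or.inr (Or.inr (Or.inr (Or.inr (Or.inl ⟨rfl, rfl⟩)))))) hP hle
      simp only [Nat.cast_ofNat, Int.cast_ofNat] at h
      subst h
      exact mem_zpowers_of_mk0_eq a (cls_P67_51_thirtyfive hθ) ha
    · exact absurd hprime (by norm_num)
    · exact absurd hprime (by norm_num)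
    · exact absurd hprime (by norm_num)
    · -- `p = 71`
      have h := eq_span_pair_of_unique_root_thirtyfive hθ h3 (Or.inr (Or.inr (Or.inr (Or.inr (Or.inr (Or.inr (Or.inl ⟨rfl, rfl⟩))))))) hP hle
      simp only [Nat.cast_ofNat, Int.cast_ofNat] at h
      subst h
      exact hprinc _ hP0 _ (P71_70_eq_thirtyfive hθ)
    · exact absurd hprime (by norm_num)
    · -- `p = 73`
      have h := eq_span_pair_of_unique_root_thirtyfive hθ h3 (Or.inr (Or.inr (Or.inr (Or.inr (Or.inr (Or.inr (Or.inr (Or.inl ⟨rfl, rfl⟩)))))))) hP hle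
      simp only [Nat.cast_ofNat, Int.cast_ofNat] at h
      subst h
      exact mem_zpowers_of_mk0_eq a (cls_P73_47_thirtyfive hθ) ha
    · exact absurd hprime (by norm_num)
    · exact absurd hprime (by norm_num)
    · exact absurd hprime (by norm_num)
    · exact absurd hprime (by norm_num)
    · exact absurd hprime (by norm_num)
    · -- `p = 79`
      have h := eq_span_pair_of_unique_root_thirtyfive hθ h3 (Or.inr (Or.inr (Or.inr (Or.inr (Or.inr (Or.inr (Or.inr (Or.inr (Or.inl ⟨rfl, rfl⟩))))))))) hP hle
      simp only [Nat.cast_ofNat, Int.cast_ofNat] at h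
      subst h
      exact mem_zpowers_of_mk0_eq a (cls_P79_70_thirtyfive hθ) ha
    · exact absurd hprime (by norm_num)
    · exact absurd hprime (by norm_num)
    · exact absurd hprime (by norm_num)
    · -- `p = 83` (splits)
      rcases eq_P83_thirtyfive hθ h3 hP with h | h | h <;> subst h
      · exact mem_zpowers_of_mk0_eq a (cls_P83_5_thirtyfive hθ) ha
      · exact mem_zpowers_of_mk0_eq a (cls_P83_12_thirtyfive hθ) ha
      · exact mem_zpowers_of_mk0_eq a (cls_P83_18_thirtyfive hθ) ha
    · exact absurd hprime (by norm_num)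
    · exact absurd hprime (by norm_num)
    · exact absurd hprime (by norm_num)
    · exact absurd hprime (by norm_num)
    · exact absurd hprime (by norm_num)
    · -- `p = 89`
      have h := eq_span_pair_of_unique_root_thirtyfive hθ h3 (Or.inr (Or.inr (Or.inr (Or.inr (Or.inr (Or.inr (Or.inr (Or.inr (Or.inr (Or.inl ⟨rfl, rfl⟩)))))))))) hP hle
      simp only [Nat.cast_ofNat, Int.cast_ofNat] at h
      subst h
      exact mem_zpowers_of_mk0_eq a (cls_P89_86_thirtyfive hθ) ha
    · exact absurd hprime (by norm_num)
    · exact absurd hprime (by norm_num)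
    · exact absurd hprime (by norm_num)
    · exact absurd hprime (by norm_num)
    · exact absurd hprime (by norm_num)
    · exact absurd hprime (by norm_num)
    · exact absurd hprime (by norm_num)
    · -- `p = 97`
      have h := eq_span_pair_of_unique_root_thirtyfive hθ h3 (Or.inr (Or.inr (Or.inr (Or.inr (Or.inr (Or.inr (Or.inr (Or.inr (Or.inr (Or.inr (Or.inl ⟨rfl, rfl⟩))))))))))) hP hle
      simp only [Nat.cast_ofNat, Int.cast_ofNat] at h
      subst h
      exact mem_zpowers_of_mk0_eq a (cls_P97_64_thirtyfive hθ) ha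
    · exact absurd hprime (by norm_num)
    · exact absurd hprime (by norm_num)
    · exact absurd hprime (by norm_num)
    · exact hprinc P hP0 _ (eq_span_of_inert_thirtyfive hθ h3 (by norm_num) hP)
    · exact absurd hprime (by norm_num)
    · -- `p = 103`
      have h := eq_span_pair_of_unique_root_thirtyfive hθ h3 (Or.inr (Or.inr (Or.inr (Or.inr (Or.inr (Or.inr (Or.inr (Or.inr (Or.inr (Or.inr (Or.inr (Or.inl ⟨rfl, rfl⟩)))))))))))) hP hle
      simp only [Nat.cast_ofNat, Int.cast_ofNat] at h
      subst h
      exact mem_zpowers_of_mk0_eq a (cls_P103_93_thirtyfive hθ) ha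
    · exact absurd hprime (by norm_num)
    · exact absurd hprime (by norm_num)
    · exact absurd hprime (by norm_num)
    · -- `p = 107`
      have h := eq_span_pair_of_unique_root_thirtyfive hθ h3 (Or.inr (Or.inr (Or.inr (Or.inr (Or.inr (Or.inr (Or.inr (Or.inr (Or.inr (Or.inr (Or.inr (Or.inr (Or.inl ⟨rfl, rfl⟩))))))))))))) hP hle
      simp only [Nat.cast_ofNat, Int.cast_ofNat] at h
      subst h
      exact mem_zpowers_of_mk0_eq a (cls_P107_80_thirtyfive hθ) ha
    · exact absurd hprime (by norm_num)
    · exact hprinc P hP0 _ (eq_span_of_inert_thirtyfive hθ h3 (by norm_num) hP)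
    · exact absurd hprime (by norm_num)
    · exact absurd hprime (by norm_num)
    · exact absurd hprime (by norm_num)
    · -- `p = 113`
      have h := eq_span_pair_of_unique_root_thirtyfive hθ h3 (Or.inr (Or.inr (Or.inr (Or.inr (Or.inr (Or.inr (Or.inr (Or.inr (Or.inr (Or.inr (Or.inr (Or.inr (Or.inr (Or.inl ⟨rfl, rfl⟩)))))))))))))) hP hle
      simp only [Nat.cast_ofNat, Int.cast_ofNat] at h
      subst h
      exact mem_zpowers_of_mk0_eq a (cls_P113_13_thirtyfive hθ) ha
    · exact absurd hprime (by norm_num)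
    · exact absurd hprime (by norm_num)
    · exact absurd hprime (by norm_num)
    · exact absurd hprime (by norm_num)
    · exact absurd hprime (by norm_num)
    · exact absurd hprime (by norm_num)
    · exact absurd hprime (by norm_num)
    · exact absurd hprime (by norm_num)
    · exact absurd hprime (by norm_num)
    · exact absurd hprime (by norm_num)
    · exact absurd hprime (by norm_num)
    · exact absurd hprime (by norm_num)
    · exact absurd hprime (by norm_num)
    · -- `p = 127`
      have h := eq_span_pair_of_unique_root_thirtyfive hθ h3 (Or.inr (Or.inr (Or.inr (Or.inr (Or.inr (Or.inr (Or.inr (Or.inr (Or.inr (Or.inr (Or.inr (Or.inr (Or.inr (Or.inr (Or.inl ⟨rfl, rfl⟩))))))))))))))) hP hle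
      simp only [Nat.cast_ofNat, Int.cast_ofNat] at h
      subst h
      exact mem_zpowers_of_mk0_eq a (cls_P127_21_thirtyfive hθ) ha
    · exact absurd hprime (by norm_num)
    · exact absurd hprime (by norm_num)
    · exact absurd hprime (by norm_num)
    · -- `p = 131`
      have h := eq_span_pair_of_unique_root_thirtyfive hθ h3 (Or.inr (Or.inr (Or.inr (Or.inr (Or.inr (Or.inr (Or.inr (Or.inr (Or.inr (Or.inr (Or.inr (Or.inr (Or.inr (Or.inr (Or.inr (Or.inl ⟨rfl, rfl⟩)))))))))))))))) hP hle
      simp only [Nat.cast_ofNat, Int.cast_ofNat] at h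
      subst h
      exact mem_zpowers_of_mk0_eq a (cls_P131_29_thirtyfive hθ) ha
    · exact absurd hprime (by norm_num)
    · exact absurd hprime (by norm_num)
    · exact absurd hprime (by norm_num)
    · exact absurd hprime (by norm_num)
    · exact absurd hprime (by norm_num)
    · exact hprinc P hP0 _ (eq_span_of_inert_thirtyfive hθ h3 (by norm_num) hP)
    · exact absurd hprime (by norm_num)
    · exact hprinc P hP0 _ (eq_span_of_inert_thirtyfive hθ h3 (by norm_num) hP)
    · exact absurd hprime (by norm_num)
    · exact absurd hprime (by norm_num)
    · exact absurd hprime (by norm_num)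
    · exact absurd hprime (by norm_num)
    · exact absurd hprime (by norm_num)
    · exact absurd hprime (by norm_num)
    · exact absurd hprime (by norm_num)
    · exact absurd hprime (by norm_num)
    · exact absurd hprime (by norm_num)
    · -- `p = 149` (splits)
      rcases eq_P149_thirtyfive hθ h3 hP with h | h | h <;> subst h
      · exact mem_zpowers_of_mk0_eq a (cls_P149_16_thirtyfive hθ) ha
      · exact mem_zpowers_of_mk0_eq a (cls_P149_79_thirtyfive hθ) ha
      · exact mem_zpowers_of_mk0_eq a (cls_P149_89_thirtyfive hθ) ha
    · exact absurd hprime (by norm_num)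
    · -- `p = 151`
      have h := eq_span_pair_of_unique_root_thirtyfive hθ h3 (Or.inr (Or.inr (Or.inr (Or.inr (Or.inr (Or.inr (Or.inr (Or.inr (Or.inr (Or.inr (Or.inr (Or.inr (Or.inr (Or.inr (Or.inr (Or.inr (Or.inl ⟨rfl, rfl⟩))))))))))))))))) hP hle
      simp only [Nat.cast_ofNat, Int.cast_ofNat] at h
      subst h
      exact mem_zpowers_of_mk0_eq a (cls_P151_33_thirtyfive hθ) ha
    · exact absurd hprime (by norm_num)
    · exact absurd hprime (by norm_num)
    · exact absurd hprime (by norm_num)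
    · exact absurd hprime (by norm_num)
    · exact absurd hprime (by norm_num)
    · -- `p = 157`
      have h := eq_span_pair_of_unique_root_thirtyfive hθ h3 (Or.inr (Or.inr (Or.inr (Or.inr (Or.inr (Or.inr (Or.inr (Or.inr (Or.inr (Or.inr (Or.inr (Or.inr (Or.inr (Or.inr (Or.inr (Or.inr (Or.inr (Or.inl ⟨rfl, rfl⟩)))))))))))))))))) hP hle
      simp only [Nat.cast_ofNat, Int.cast_ofNat] at h
      subst h
      exact mem_zpowers_of_mk0_eq a (cls_P157_117_thirtyfive hθ) ha
    · exact absurd hprime (by norm_num)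
    · exact absurd hprime (by norm_num)
    · exact absurd hprime (by norm_num)
    · exact absurd hprime (by norm_num)
    · exact absurd hprime (by norm_num)
    · exact hprinc P hP0 _ (eq_span_of_inert_thirtyfive hθ h3 (by norm_num) hP)
    · exact absurd hprime (by norm_num)
    · exact absurd hprime (by norm_num)
    · exact absurd hprime (by norm_num)
    · exact hprinc P hP0 _ (eq_span_of_inert_thirtyfive hθ h3 (by norm_num) hP)
    · exact absurd hprime (by norm_num)
    · exact absurd hprime (by norm_num)
    · exact absurd hprime (by norm_num)
    · exact absurd hprime (by norm_num)
    · exact absurd hprime (by norm_num)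
    · -- `p = 173`
      have h := eq_span_pair_of_unique_root_thirtyfive hθ h3 (Or.inr (Or.inr (Or.inr (Or.inr (Or.inr (Or.inr (Or.inr (Or.inr (Or.inr (Or.inr (Or.inr (Or.inr (Or.inr (Or.inr (Or.inr (Or.inr (Or.inr (Or.inr (Or.inl ⟨rfl, rfl⟩))))))))))))))))))) hP hle
      simp only [Nat.cast_ofNat, Int.cast_ofNat] at h
      subst h
      exact hprinc _ hP0 _ (P173_116_eq_thirtyfive hθ)
    · exact absurd hprime (by norm_num)
    · exact absurd hprime (by norm_num)
    · exact absurd hprime (by norm_num)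
    · exact absurd hprime (by norm_num)
    · exact absurd hprime (by norm_num)
    · exact hprinc P hP0 _ (eq_span_of_inert_thirtyfive hθ h3 (by norm_num) hP)
    · exact absurd hprime (by norm_num)
    · exact hprinc P hP0 _ (eq_span_of_inert_thirtyfive hθ h3 (by norm_num) hP)
    · exact absurd hprime (by norm_num)
    · exact absurd hprime (by norm_num)
    · exact absurd hprime (by norm_num)
    · exact absurd hprime (by norm_num)
    · exact absurd hprime (by norm_num)
    · exact absurd hprime (by norm_num)
    · exact absurd hprime (by norm_num)
    · exact absurd hprime (by norm_num)
    · exact absurd hprime (by norm_num)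
    · -- `p = 191`
      have h := eq_span_pair_of_unique_root_thirtyfive hθ h3 (Or.inr (Or.inr (Or.inr (Or.inr (Or.inr (Or.inr (Or.inr (Or.inr (Or.inr (Or.inr (Or.inr (Or.inr (Or.inr (Or.inr (Or.inr (Or.inr (Or.inr (Or.inr (Or.inr (Or.inl ⟨rfl, rfl⟩)))))))))))))))))))) hP hle
      simp only [Nat.cast_ofNat, Int.cast_ofNat] at h
      subst h
      exact mem_zpowers_of_mk0_eq a (cls_P191_40_thirtyfive hθ) ha
    · exact absurd hprime (by norm_num)
    · exact hprinc P hP0 _ (eq_span_of_inert_thirtyfive hθ h3 (by norm_num) hP)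
    · exact absurd hprime (by norm_num)
    · exact absurd hprime (by norm_num)
    · exact absurd hprime (by norm_num)
    · exact hprinc P hP0 _ (eq_span_of_inert_thirtyfive hθ h3 (by norm_num) hP)
    · exact absurd hprime (by norm_num)
    · -- `p = 199`
      have h := eq_span_pair_of_unique_root_thirtyfive hθ h3 (Or.inr (Or.inr (Or.inr (Or.inr (Or.inr (Or.inr (Or.inr (Or.inr (Or.inr (Or.inr (Or.inr (Or.inr (Or.inr (Or.inr (Or.inr (Or.inr (Or.inr (Or.inr (Or.inr (Or.inr (Or.inl ⟨rfl, rfl⟩))))))))))))))))))))) hP hle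
      simp only [Nat.cast_ofNat, Int.cast_ofNat] at h
      subst h
      exact mem_zpowers_of_mk0_eq a (cls_P199_158_thirtyfive hθ) ha
    · exact absurd hprime (by norm_num)
    · exact absurd hprime (by norm_num)
    · exact absurd hprime (by norm_num)
    · exact absurd hprime (by norm_num)
    · exact absurd hprime (by norm_num)
    · exact absurd hprime (by norm_num)
    · exact absurd hprime (by norm_num)
    · exact absurd hprime (by norm_num)
    · exact absurd hprime (by norm_num)
    · exact absurd hprime (by norm_num)
    · exact absurd hprime (by norm_num)
    · exact hprinc P hP0 _ (eq_span_of_inert_thirtyfive hθ h3 (by norm_num) hP)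
    · exact absurd hprime (by norm_num)
    · exact absurd hprime (by norm_num)
    · exact absurd hprime (by norm_num)
    · exact absurd hprime (by norm_num)
    · exact absurd hprime (by norm_num)
    · exact absurd hprime (by norm_num)
    · exact absurd hprime (by norm_num)
    · exact absurd hprime (by norm_num)
    · exact absurd hprime (by norm_num)
    · exact absurd hprime (by norm_num)
    · exact absurd hprime (by norm_num)
    · -- `p = 223`
      have h := eq_span_pair_of_unique_root_thirtyfive hθ h3 (Or.inr (Or.inr (Or.inr (Or.inr (Or.inr (Or.inr (Or.inr (Or.inr (Or.inr (Or.inr (Or.inr (Or.inr (Or.inr (Or.inr (Or.inr (Or.inr (Or.inr (Or.inr (Or.inr (Or.inr (Or.inr (Or.inl ⟨rfl, rfl⟩)))))))))))))))))))))) hP hle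
      simp only [Nat.cast_ofNat, Int.cast_ofNat] at h
      subst h
      exact mem_zpowers_of_mk0_eq a (cls_P223_152_thirtyfive hθ) ha
    · exact absurd hprime (by norm_num)
    · exact absurd hprime (by norm_num)
    · exact absurd hprime (by norm_num)
    · -- `p = 227` (splits)
      rcases eq_P227_thirtyfive hθ h3 hP with h | h | h <;> subst h
      · exact mem_zpowers_of_mk0_eq a (cls_P227_7_thirtyfive hθ) ha
      · exact mem_zpowers_of_mk0_eq a (cls_P227_63_thirtyfive hθ) ha
      · exact mem_zpowers_of_mk0_eq a (cls_P227_192_thirtyfive hθ) ha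
    · exact absurd hprime (by norm_num)
    · -- `p = 229`
      have h := eq_span_pair_of_unique_root_thirtyfive hθ h3 (Or.inr (Or.inr (Or.inr (Or.inr (Or.inr (Or.inr (Or.inr (Or.inr (Or.inr (Or.inr (Or.inr (Or.inr (Or.inr (Or.inr (Or.inr (Or.inr (Or.inr (Or.inr (Or.inr (Or.inr (Or.inr (Or.inr (Or.inl ⟨rfl, rfl⟩))))))))))))))))))))))) hP hle
      simp only [Nat.cast_ofNat, Int.cast_ofNat] at h
      subst h
      exact mem_zpowers_of_mk0_eq a (cls_P229_36_thirtyfive hθ) ha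
    · exact absurd hprime (by norm_num)
    · exact absurd hprime (by norm_num)
    · exact absurd hprime (by norm_num)
    · -- `p = 233`
      have h := eq_span_pair_of_unique_root_thirtyfive hθ h3 (Or.inr (Or.inr (Or.inr (Or.inr (Or.inr (Or.inr (Or.inr (Or.inr (Or.inr (Or.inr (Or.inr (Or.inr (Or.inr (Or.inr (Or.inr (Or.inr (Or.inr (Or.inr (Or.inr (Or.inr (Or.inr (Or.inr (Or.inr (⟨rfl, rfl⟩)))))))))))))))))))))))) hP hle
      simp only [Nat.cast_ofNat, Int.cast_ofNat] at h
      subst h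
      exact mem_zpowers_of_mk0_eq a (cls_P233_114_thirtyfive hθ) ha
  have hC : C ∈ H := by rw [htop]; exact Subgroup.mem_top C
  obtain ⟨k, rfl⟩ := Subgroup.mem_zpowers_iff.mp hC
  obtain ⟨q, r, hr, rfl⟩ : ∃ q r : ℤ, (r = 0 ∨ r = 1 ∨ r = 2 ∨ r = 3 ∨ r = 4 ∨ r = 5 ∨ r = 6 ∨ r = 7 ∨ r = 8 ∨ r = 9) ∧ k = 10 * q + r :=
    ⟨k / 10, k % 10, by omega, by omega⟩
  rw [zpow_add, zpow_mul, ham, one_zpow, one_mul]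
  rcases hr with rfl | rfl | rfl | rfl | rfl | rfl | rfl | rfl | rfl | rfl
  · exact Or.inl (zpow_zero a)
  · right; left
    rw [show (1 : ℤ) = 1 + 10 * (0) by norm_num, zpow_add, zpow_mul, ham, one_zpow, mul_one,
      zpow_one, ← ha]
  · right; right; left
    rw [show (2 : ℤ) = 2 + 10 * (0) by norm_num, zpow_add, zpow_mul, ham, one_zpow, mul_one,
      ← ha, ← cls_P29_16_thirtyfive hθ]
  · right; right; right; left
    rw [show (3 : ℤ) = 3 + 10 * (0) by norm_num, zpow_add, zpow_mul, ham, one_zpow, mul_one,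
      ← ha, ← cls_P29_13_thirtyfive hθ]
  · right; right; right; right; left
    rw [show (4 : ℤ) = 4 + 10 * (0) by norm_num, zpow_add, zpow_mul, ham, one_zpow, mul_one,
      ← ha, ← cls_P11_3_thirtyfive hθ]
  · right; right; right; right; right; left
    rw [show (5 : ℤ) = -5 + 10 * (1) by norm_num, zpow_add, zpow_mul, ham, one_zpow, mul_one,
      ← ha, ← cls_P19_4_thirtyfive hθ]
  · right; right; right; right; right; right; left
    rw [show (6 : ℤ) = -4 + 10 * (1) by norm_num, zpow_add, zpow_mul, ham, one_zpow, mul_one,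
      ← ha, ← cls_P17_3_thirtyfive hθ]
  · right; right; right; right; right; right; right; left
    rw [show (7 : ℤ) = -3 + 10 * (1) by norm_num, zpow_add, zpow_mul, ham, one_zpow, mul_one,
      ← ha, ← cls_P37_17_thirtyfive hθ]
  · right; right; right; right; right; right; right; right; left
    rw [show (8 : ℤ) = -2 + 10 * (1) by norm_num, zpow_add, zpow_mul, ham, one_zpow, mul_one,
      ← ha, ← cls_P7_5_thirtyfive hθ]
  · right; right; right; right; right; right; right; right; right
    rw [show (9 : ℤ) = -1 + 10 * (1) by norm_num, zpow_add, zpow_mul, ham, one_zpow, mul_one,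
      ← ha, ← cls_P13_2_thirtyfive hθ]


end Field


/-! ### The ideal classes of `ℤ[X]/(f₃₅)` and Gompf's conjecture for the traces `35` and `-30` -/

section Matrices

set_option maxHeartbeats 1000000 in
/-- **The ideal classes of `ℤ[Θ₃₅] = ℤ[X]/(f₃₅)`**: every non-zero ideal is in the class of one of
`⟨Θ - 1, 1⟩`, `⟨Θ - 2, 5⟩`, `⟨Θ - 16, 29⟩`, `⟨Θ - 13, 29⟩`, `⟨Θ - 3, 11⟩`, `⟨Θ - 4, 19⟩`, `⟨Θ - 3, 17⟩`, `⟨Θ - 17, 37⟩`, `⟨Θ - 5, 7⟩`, `⟨Θ - 2, 13⟩` (these representatives cover `C(ℤ[Θ₃₅])`). [cite: KimYamada2023, §6.1 (proof of Thm. B)] -/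
theorem ideal_class_adjoinRoot_thirtyfive (J : Ideal (AdjoinRoot (csPoly 35))) (hJ : J ≠ ⊥) :
    ∃ x y : AdjoinRoot (csPoly 35), x ≠ 0 ∧ y ≠ 0 ∧
      (span {x} * J = span {y} * csIdeal 1 1 35 ∨ span {x} * J = span {y} * csIdeal 2 5 35 ∨ span {x} * J = span {y} * csIdeal 16 29 35 ∨ span {x} * J = span {y} * csIdeal 13 29 35 ∨ span {x} * J = span {y} * csIdeal 3 11 35 ∨ span {x} * J = span {y} * csIdeal 4 19 35 ∨ span {x} * J = span {y} * csIdeal 3 17 35 ∨ span {x} * J = span {y} * csIdeal 17 37 35 ∨ span {x} * J = span {y} * csIdeal 5 7 35 ∨ span {x} * J = span {y} * csIdeal 2 13 35) := by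
  classical
  set θ' := AdjoinRoot.root (csPolyQ 35) with hθ'
  have hθ : aeval θ' (csPoly 35) = 0 := aeval_root_csPoly 35
  have h3 : finrank ℚ (CSField 35) = 3 := finrank_CSField 35
  obtain ⟨e, he⟩ := exists_ringEquiv_adjoinRoot_of_sq hθ h3 csDisc_thirtyfive_sq
  set I : Ideal (𝓞 (CSField 35)) := J.map e with hI
  have hIJ : I.map (e.symm : 𝓞 (CSField 35) →+* AdjoinRoot (csPoly 35)) = J := by
    rw [hI]
    exact Ideal.map_of_equiv e (I := J)
  have hI0 : I ≠ ⊥ := by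
    intro h0
    apply hJ
    rw [← hIJ, h0, Ideal.map_bot]
  have hImem : I ∈ (Ideal (𝓞 (CSField 35)))⁰ := mem_nonZeroDivisors_iff_ne_zero.mpr hI0
  have hsymm : ∀ x, (e.symm : 𝓞 (CSField 35) →+* AdjoinRoot (csPoly 35)) (e x) = x :=
    fun x => e.symm_apply_apply x
  have hP5_2 : (span {(5 : 𝓞 (CSField 35)), thetaInt hθ - 2}).map
      (e.symm : 𝓞 (CSField 35) →+* AdjoinRoot (csPoly 35)) = csIdeal 2 5 35 := by
    rw [Ideal.map_span, Set.image_insert_eq, Set.image_singleton, map_sub, ← he, hsymm, map_ofNat,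
      map_ofNat, csIdeal, Set.pair_comm]
    simp
  have hP29_16 : (span {(29 : 𝓞 (CSField 35)), thetaInt hθ - 16}).map
      (e.symm : 𝓞 (CSField 35) →+* AdjoinRoot (csPoly 35)) = csIdeal 16 29 35 := by
    rw [Ideal.map_span, Set.image_insert_eq, Set.image_singleton, map_sub, ← he, hsymm, map_ofNat,
      map_ofNat, csIdeal, Set.pair_comm]
    simp
  have hP29_13 : (span {(29 : 𝓞 (CSField 35)), thetaInt hθ - 13}).map
      (e.symm : 𝓞 (CSField 35) →+* AdjoinRoot (csPoly 35)) = csIdeal 13 29 35 := by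
    rw [Ideal.map_span, Set.image_insert_eq, Set.image_singleton, map_sub, ← he, hsymm, map_ofNat,
      map_ofNat, csIdeal, Set.pair_comm]
    simp
  have hP11_3 : (span {(11 : 𝓞 (CSField 35)), thetaInt hθ - 3}).map
      (e.symm : 𝓞 (CSField 35) →+* AdjoinRoot (csPoly 35)) = csIdeal 3 11 35 := by
    rw [Ideal.map_span, Set.image_insert_eq, Set.image_singleton, map_sub, ← he, hsymm, map_ofNat,
      map_ofNat, csIdeal, Set.pair_comm]
    simp
  have hP19_4 : (span {(19 : 𝓞 (CSField 35)), thetaInt hθ - 4}).map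
      (e.symm : 𝓞 (CSField 35) →+* AdjoinRoot (csPoly 35)) = csIdeal 4 19 35 := by
    rw [Ideal.map_span, Set.image_insert_eq, Set.image_singleton, map_sub, ← he, hsymm, map_ofNat,
      map_ofNat, csIdeal, Set.pair_comm]
    simp
  have hP17_3 : (span {(17 : 𝓞 (CSField 35)), thetaInt hθ - 3}).map
      (e.symm : 𝓞 (CSField 35) →+* AdjoinRoot (csPoly 35)) = csIdeal 3 17 35 := by
    rw [Ideal.map_span, Set.image_insert_eq, Set.image_singleton, map_sub, ← he, hsymm, map_ofNat,
      map_ofNat, csIdeal, Set.pair_comm]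
    simp
  have hP37_17 : (span {(37 : 𝓞 (CSField 35)), thetaInt hθ - 17}).map
      (e.symm : 𝓞 (CSField 35) →+* AdjoinRoot (csPoly 35)) = csIdeal 17 37 35 := by
    rw [Ideal.map_span, Set.image_insert_eq, Set.image_singleton, map_sub, ← he, hsymm, map_ofNat,
      map_ofNat, csIdeal, Set.pair_comm]
    simp
  have hP7_5 : (span {(7 : 𝓞 (CSField 35)), thetaInt hθ - 5}).map
      (e.symm : 𝓞 (CSField 35) →+* AdjoinRoot (csPoly 35)) = csIdeal 5 7 35 := by
    rw [Ideal.map_span, Set.image_insert_eq, Set.image_singleton, map_sub, ← he, hsymm, map_ofNat,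
      map_ofNat, csIdeal, Set.pair_comm]
    simp
  have hP13_2 : (span {(13 : 𝓞 (CSField 35)), thetaInt hθ - 2}).map
      (e.symm : 𝓞 (CSField 35) →+* AdjoinRoot (csPoly 35)) = csIdeal 2 13 35 := by
    rw [Ideal.map_span, Set.image_insert_eq, Set.image_singleton, map_sub, ← he, hsymm, map_ofNat,
      map_ofNat, csIdeal, Set.pair_comm]
    simp
  have hcase : ∀ (P : Ideal (𝓞 (CSField 35))) (hP0 : P ∈ (Ideal (𝓞 (CSField 35)))⁰)
      (Q : Ideal (AdjoinRoot (csPoly 35))),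
      P.map (e.symm : 𝓞 (CSField 35) →+* AdjoinRoot (csPoly 35)) = Q →
      ClassGroup.mk0 ⟨I, hImem⟩ = ClassGroup.mk0 ⟨P, hP0⟩ →
        ∃ x y : AdjoinRoot (csPoly 35), x ≠ 0 ∧ y ≠ 0 ∧ span {x} * J = span {y} * Q := by
    intro P hP0 Q hPQ hcls
    obtain ⟨x, y, hx, hy, hxy⟩ := ClassGroup.mk0_eq_mk0_iff.mp hcls
    refine ⟨(e.symm : 𝓞 (CSField 35) →+* AdjoinRoot (csPoly 35)) x,
      (e.symm : 𝓞 (CSField 35) →+* AdjoinRoot (csPoly 35)) y,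
      (map_ne_zero_iff _ e.symm.injective).mpr hx, (map_ne_zero_iff _ e.symm.injective).mpr hy, ?_⟩
    have h := congrArg (Ideal.map (e.symm : 𝓞 (CSField 35) →+* AdjoinRoot (csPoly 35))) hxy
    simp only [Ideal.map_mul, Ideal.map_span, Set.image_singleton] at h
    rw [hIJ, hPQ] at h
    exact h
  rcases classGroup_mem_thirtyfive hθ h3 (ClassGroup.mk0 ⟨I, hImem⟩) with h1 | hcl | hcl | hcl | hcl | hcl | hcl | hcl | hcl | hcl
  · obtain ⟨z, hz⟩ := ((ClassGroup.mk0_eq_one_iff hImem).mp h1).principal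
    have hz' : I = span {z} := by rw [hz, submodule_span_eq]
    have hz0 : z ≠ 0 := by
      rintro rfl
      apply hI0
      rw [hz', Ideal.span_singleton_eq_bot]
    refine ⟨1, (e.symm : 𝓞 (CSField 35) →+* AdjoinRoot (csPoly 35)) z, one_ne_zero,
      (map_ne_zero_iff _ e.symm.injective).mpr hz0, Or.inl ?_⟩
    rw [Ideal.span_singleton_one, Ideal.top_mul, csIdeal_one_one, Ideal.mul_top, ← hIJ, hz',
      Ideal.map_span, Set.image_singleton]
  · obtain ⟨x, y, hx, hy, h⟩ := hcase _ _ _ hP5_2 hcl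
    exact ⟨x, y, hx, hy, Or.inr (Or.inl h)⟩
  · obtain ⟨x, y, hx, hy, h⟩ := hcase _ _ _ hP29_16 hcl
    exact ⟨x, y, hx, hy, Or.inr (Or.inr (Or.inl h))⟩
  · obtain ⟨x, y, hx, hy, h⟩ := hcase _ _ _ hP29_13 hcl
    exact ⟨x, y, hx, hy, Or.inr (Or.inr (Or.inr (Or.inl h)))⟩
  · obtain ⟨x, y, hx, hy, h⟩ := hcase _ _ _ hP11_3 hcl
    exact ⟨x, y, hx, hy, Or.inr (Or.inr (Or.inr (Or.inr (Or.inl h))))⟩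
  · obtain ⟨x, y, hx, hy, h⟩ := hcase _ _ _ hP19_4 hcl
    exact ⟨x, y, hx, hy, Or.inr (Or.inr (Or.inr (Or.inr (Or.inr (Or.inl h)))))⟩
  · obtain ⟨x, y, hx, hy, h⟩ := hcase _ _ _ hP17_3 hcl
    exact ⟨x, y, hx, hy, Or.inr (Or.inr (Or.inr (Or.inr (Or.inr (Or.inr (Or.inl h))))))⟩
  · obtain ⟨x, y, hx, hy, h⟩ := hcase _ _ _ hP37_17 hcl
    exact ⟨x, y, hx, hy, Or.inr (Or.inr (Or.inr (Or.inr (Or.inr (Or.inr (Or.inr (Or.inl h)))))))⟩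
  · obtain ⟨x, y, hx, hy, h⟩ := hcase _ _ _ hP7_5 hcl
    exact ⟨x, y, hx, hy, Or.inr (Or.inr (Or.inr (Or.inr (Or.inr (Or.inr (Or.inr (Or.inr (Or.inl h))))))))⟩
  · obtain ⟨x, y, hx, hy, h⟩ := hcase _ _ _ hP13_2 hcl
    exact ⟨x, y, hx, hy, Or.inr (Or.inr (Or.inr (Or.inr (Or.inr (Or.inr (Or.inr (Or.inr (Or.inr (h)))))))))⟩

/-- `5 ∣ f₃₅(2)`: `(2, 5, 35) ∈ 𝒞𝒮`. [cite: KimYamada2023, §6.1 (proof of Thm. B)] -/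
theorem rep0_dvd_eval_csPoly_thirtyfive : (5 : ℤ) ∣ (csPoly 35).eval 2 := by
  rw [eval_csPoly]; norm_num

/-- `29 ∣ f₃₅(16)`: `(16, 29, 35) ∈ 𝒞𝒮`. [cite: KimYamada2023, §6.1 (proof of Thm. B)] -/
theorem rep1_dvd_eval_csPoly_thirtyfive : (29 : ℤ) ∣ (csPoly 35).eval 16 := by
  rw [eval_csPoly]; norm_num

/-- `29 ∣ f₃₅(13)`: `(13, 29, 35) ∈ 𝒞𝒮`. [cite: KimYamada2023, §6.1 (proof of Thm. B)] -/
theorem rep2_dvd_eval_csPoly_thirtyfive : (29 : ℤ) ∣ (csPoly 35).eval 13 := by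
  rw [eval_csPoly]; norm_num

/-- `11 ∣ f₃₅(3)`: `(3, 11, 35) ∈ 𝒞𝒮`. [cite: KimYamada2023, §6.1 (proof of Thm. B)] -/
theorem rep3_dvd_eval_csPoly_thirtyfive : (11 : ℤ) ∣ (csPoly 35).eval 3 := by
  rw [eval_csPoly]; norm_num

/-- `19 ∣ f₃₅(4)`: `(4, 19, 35) ∈ 𝒞𝒮`. [cite: KimYamada2023, §6.1 (proof of Thm. B)] -/
theorem rep4_dvd_eval_csPoly_thirtyfive : (19 : ℤ) ∣ (csPoly 35).eval 4 := by
  rw [eval_csPoly]; norm_num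

/-- `17 ∣ f₃₅(3)`: `(3, 17, 35) ∈ 𝒞𝒮`. [cite: KimYamada2023, §6.1 (proof of Thm. B)] -/
theorem rep5_dvd_eval_csPoly_thirtyfive : (17 : ℤ) ∣ (csPoly 35).eval 3 := by
  rw [eval_csPoly]; norm_num

/-- `37 ∣ f₃₅(17)`: `(17, 37, 35) ∈ 𝒞𝒮`. [cite: KimYamada2023, §6.1 (proof of Thm. B)] -/
theorem rep6_dvd_eval_csPoly_thirtyfive : (37 : ℤ) ∣ (csPoly 35).eval 17 := by
  rw [eval_csPoly]; norm_num

/-- `7 ∣ f₃₅(5)`: `(5, 7, 35) ∈ 𝒞𝒮`. [cite: KimYamada2023, §6.1 (proof of Thm. B)] -/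
theorem rep7_dvd_eval_csPoly_thirtyfive : (7 : ℤ) ∣ (csPoly 35).eval 5 := by
  rw [eval_csPoly]; norm_num

/-- `13 ∣ f₃₅(2)`: `(2, 13, 35) ∈ 𝒞𝒮`. [cite: KimYamada2023, §6.1 (proof of Thm. B)] -/
theorem rep8_dvd_eval_csPoly_thirtyfive : (13 : ℤ) ∣ (csPoly 35).eval 2 := by
  rw [eval_csPoly]; norm_num

/-- **Every Cappell–Shaneson matrix of trace `35` is similar to one of 10 standard matrices**
(Prop. 2.14). [cite: KimYamada2023, §6.1 (proof of Thm. B) and Prop. 2.14] -/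
theorem isConj_standardCSMatrix_of_trace_eq_thirtyfive (A : SL(3, ℤ))
    (hdet : ((A : Matrix (Fin 3) (Fin 3) ℤ) - 1).det = 1)
    (htr : Matrix.trace (A : Matrix (Fin 3) (Fin 3) ℤ) = 35) :
    IsConj A (standardCSMatrix 1 1 35 (one_dvd _)) ∨
      IsConj A (standardCSMatrix 2 5 35 rep0_dvd_eval_csPoly_thirtyfive) ∨
      IsConj A (standardCSMatrix 16 29 35 rep1_dvd_eval_csPoly_thirtyfive) ∨
      IsConj A (standardCSMatrix 13 29 35 rep2_dvd_eval_csPoly_thirtyfive) ∨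
      IsConj A (standardCSMatrix 3 11 35 rep3_dvd_eval_csPoly_thirtyfive) ∨
      IsConj A (standardCSMatrix 4 19 35 rep4_dvd_eval_csPoly_thirtyfive) ∨
      IsConj A (standardCSMatrix 3 17 35 rep5_dvd_eval_csPoly_thirtyfive) ∨
      IsConj A (standardCSMatrix 17 37 35 rep6_dvd_eval_csPoly_thirtyfive) ∨
      IsConj A (standardCSMatrix 5 7 35 rep7_dvd_eval_csPoly_thirtyfive) ∨
      IsConj A (standardCSMatrix 2 13 35 rep8_dvd_eval_csPoly_thirtyfive) := by
  have hcover : ∀ J : Ideal (AdjoinRoot (csPoly 35)), J ≠ ⊥ →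
      ∃ (c d : ℤ) (_ : d ∣ (csPoly 35).eval c) (x y : AdjoinRoot (csPoly 35)),
        x ≠ 0 ∧ y ≠ 0 ∧ Ideal.span {x} * J = Ideal.span {y} * csIdeal c d 35 ∧
          ((c = 1 ∧ d = 1) ∨ (c = 2 ∧ d = 5) ∨ (c = 16 ∧ d = 29) ∨ (c = 13 ∧ d = 29) ∨ (c = 3 ∧ d = 11) ∨ (c = 4 ∧ d = 19) ∨ (c = 3 ∧ d = 17) ∨ (c = 17 ∧ d = 37) ∨ (c = 5 ∧ d = 7) ∨ (c = 2 ∧ d = 13)) := by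
    intro J hJ
    obtain ⟨x, y, hx, hy, hxy⟩ := ideal_class_adjoinRoot_thirtyfive J hJ
    rcases hxy with h0 | h1 | h2 | h3 | h4 | h5 | h6 | h7 | h8 | h9
    · exact ⟨1, 1, one_dvd _, x, y, hx, hy, h0, Or.inl ⟨rfl, rfl⟩⟩
    · exact ⟨2, 5, rep0_dvd_eval_csPoly_thirtyfive, x, y, hx, hy, h1, Or.inr (Or.inl ⟨rfl, rfl⟩)⟩
    · exact ⟨16, 29, rep1_dvd_eval_csPoly_thirtyfive, x, y, hx, hy, h2, Or.inr (Or.inr (Or.inl ⟨rfl, rfl⟩))⟩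
    · exact ⟨13, 29, rep2_dvd_eval_csPoly_thirtyfive, x, y, hx, hy, h3, Or.inr (Or.inr (Or.inr (Or.inl ⟨rfl, rfl⟩)))⟩
    · exact ⟨3, 11, rep3_dvd_eval_csPoly_thirtyfive, x, y, hx, hy, h4, Or.inr (Or.inr (Or.inr (Or.inr (Or.inl ⟨rfl, rfl⟩))))⟩
    · exact ⟨4, 19, rep4_dvd_eval_csPoly_thirtyfive, x, y, hx, hy, h5, Or.inr (Or.inr (Or.inr (Or.inr (Or.inr (Or.inl ⟨rfl, rfl⟩)))))⟩
    · exact ⟨3, 17, rep5_dvd_eval_csPoly_thirtyfive, x, y, hx, hy, h6, Or.inr (Or.inr (Or.inr (Or.inr (Or.inr (Or.inr (Or.inl ⟨rfl, rfl⟩))))))⟩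
    · exact ⟨17, 37, rep6_dvd_eval_csPoly_thirtyfive, x, y, hx, hy, h7, Or.inr (Or.inr (Or.inr (Or.inr (Or.inr (Or.inr (Or.inr (Or.inl ⟨rfl, rfl⟩)))))))⟩
    · exact ⟨5, 7, rep7_dvd_eval_csPoly_thirtyfive, x, y, hx, hy, h8, Or.inr (Or.inr (Or.inr (Or.inr (Or.inr (Or.inr (Or.inr (Or.inr (Or.inl ⟨rfl, rfl⟩))))))))⟩
    · exact ⟨2, 13, rep8_dvd_eval_csPoly_thirtyfive, x, y, hx, hy, h9, Or.inr (Or.inr (Or.inr (Or.inr (Or.inr (Or.inr (Or.inr (Or.inr (Or.inr (⟨rfl, rfl⟩)))))))))⟩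
  obtain ⟨c, d, h, hconj, hcd⟩ := exists_isConj_standardCSMatrix_of_cover _ hcover A hdet htr
  rcases hcd with ⟨rfl, rfl⟩ | ⟨rfl, rfl⟩ | ⟨rfl, rfl⟩ | ⟨rfl, rfl⟩ | ⟨rfl, rfl⟩ | ⟨rfl, rfl⟩ | ⟨rfl, rfl⟩ | ⟨rfl, rfl⟩ | ⟨rfl, rfl⟩ | ⟨rfl, rfl⟩
  · exact Or.inl hconj
  · exact Or.inr (Or.inl hconj)
  · exact Or.inr (Or.inr (Or.inl hconj))
  · exact Or.inr (Or.inr (Or.inr (Or.inl hconj)))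
  · exact Or.inr (Or.inr (Or.inr (Or.inr (Or.inl hconj))))
  · exact Or.inr (Or.inr (Or.inr (Or.inr (Or.inr (Or.inl hconj)))))
  · exact Or.inr (Or.inr (Or.inr (Or.inr (Or.inr (Or.inr (Or.inl hconj))))))
  · exact Or.inr (Or.inr (Or.inr (Or.inr (Or.inr (Or.inr (Or.inr (Or.inl hconj)))))))
  · exact Or.inr (Or.inr (Or.inr (Or.inr (Or.inr (Or.inr (Or.inr (Or.inr (Or.inl hconj))))))))
  · exact Or.inr (Or.inr (Or.inr (Or.inr (Or.inr (Or.inr (Or.inr (Or.inr (Or.inr (hconj)))))))))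

/-- **Kim–Yamada 2023, Theorem B for the trace `35`, PROVED**: the non-trivial classes move by
Gompf moves to the traces `0` (from `(2, 5, 35)`), `6` (from `(16, 29, 35)`), `6` (from `(13, 29, 35)`), `2` (from `(3, 11, 35)`), `-3` (from `(4, 19, 35)`), `1` (from `(3, 17, 35)`), `-2` (from `(17, 37, 35)`), `0` (from `(5, 7, 35)`), `-4` (from `(2, 13, 35)`), where Gompf's conjecture holds. [cite: KimYamada2023, Thm. B, Lemma 6.1 and §6.1] -/
theorem gompfConjectureForTrace_thirtyfive : GompfConjectureForTrace 35 := by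
  intro A hdet htr
  rcases isConj_standardCSMatrix_of_trace_eq_thirtyfive A hdet htr with h0 | h1 | h2 | h3 | h4 | h5 | h6 | h7 | h8 | h9
  · exact (GompfEquiv.of_isConj h0).trans (gompfEquiv_standardCSMatrix_one_one 33 (one_dvd _))
  · exact (GompfEquiv.of_isConj h1).trans
      (gompfEquiv_standardCSMatrix_akbulutKirbyMatrix_of_modEq
        (gompfConjectureForTrace_of_mem_Icc_neg_seven_twelve (by norm_num)) rep0_dvd_eval_csPoly_thirtyfive
        (show (35 : ℤ) ≡ 0 [ZMOD 5] by decide))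
  · exact (GompfEquiv.of_isConj h2).trans
      (gompfEquiv_standardCSMatrix_akbulutKirbyMatrix_of_modEq
        (gompfConjectureForTrace_of_mem_Icc_neg_seven_twelve (by norm_num)) rep1_dvd_eval_csPoly_thirtyfive
        (show (35 : ℤ) ≡ 6 [ZMOD 29] by decide))
  · exact (GompfEquiv.of_isConj h3).trans
      (gompfEquiv_standardCSMatrix_akbulutKirbyMatrix_of_modEq
        (gompfConjectureForTrace_of_mem_Icc_neg_seven_twelve (by norm_num)) rep2_dvd_eval_csPoly_thirtyfive
        (show (35 : ℤ) ≡ 6 [ZMOD 29] by decide))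
  · exact (GompfEquiv.of_isConj h4).trans
      (gompfEquiv_standardCSMatrix_akbulutKirbyMatrix_of_modEq
        (gompfConjectureForTrace_of_mem_Icc_neg_seven_twelve (by norm_num)) rep3_dvd_eval_csPoly_thirtyfive
        (show (35 : ℤ) ≡ 2 [ZMOD 11] by decide))
  · exact (GompfEquiv.of_isConj h5).trans
      (gompfEquiv_standardCSMatrix_akbulutKirbyMatrix_of_modEq
        (gompfConjectureForTrace_of_mem_Icc_neg_seven_twelve (by norm_num)) rep4_dvd_eval_csPoly_thirtyfive
        (show (35 : ℤ) ≡ -3 [ZMOD 19] by decide))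
  · exact (GompfEquiv.of_isConj h6).trans
      (gompfEquiv_standardCSMatrix_akbulutKirbyMatrix_of_modEq
        (gompfConjectureForTrace_of_mem_Icc_neg_seven_twelve (by norm_num)) rep5_dvd_eval_csPoly_thirtyfive
        (show (35 : ℤ) ≡ 1 [ZMOD 17] by decide))
  · exact (GompfEquiv.of_isConj h7).trans
      (gompfEquiv_standardCSMatrix_akbulutKirbyMatrix_of_modEq
        (gompfConjectureForTrace_of_mem_Icc_neg_seven_twelve (by norm_num)) rep6_dvd_eval_csPoly_thirtyfive
        (show (35 : ℤ) ≡ -2 [ZMOD 37] by decide))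
  · exact (GompfEquiv.of_isConj h8).trans
      (gompfEquiv_standardCSMatrix_akbulutKirbyMatrix_of_modEq
        (gompfConjectureForTrace_of_mem_Icc_neg_seven_twelve (by norm_num)) rep7_dvd_eval_csPoly_thirtyfive
        (show (35 : ℤ) ≡ 0 [ZMOD 7] by decide))
  · exact (GompfEquiv.of_isConj h9).trans
      (gompfEquiv_standardCSMatrix_akbulutKirbyMatrix_of_modEq
        (gompfConjectureForTrace_of_mem_Icc_neg_seven_twelve (by norm_num)) rep8_dvd_eval_csPoly_thirtyfive
        (show (35 : ℤ) ≡ -4 [ZMOD 13] by decide))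

/-- **Theorem B for the trace `-30`** (`= 5 - 35`), by Theorem A. [cite: KimYamada2023, Thm. A and Thm. B] -/
theorem gompfConjectureForTrace_neg_thirty : GompfConjectureForTrace (-30) := by
  have h := gompfConjectureForTrace_of_five_sub gompfConjectureForTrace_thirtyfive
  norm_num at h
  exact h

end Matrices


end Literature.Topology.FourManifolds

end
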